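import Summits.KontsevichZagierPeriods.KontsevichZagierPeriods.Theorems.RootDecompWalshStrataHtypeSections

/-!
# Root decomposition (Walsh strata), part 48b — H-type fibre discriminants II′: the section dispatcher

The dispatcher `InBaker.of_Hsections` sorts the boundary sections `[S, P(v, ζ(v))]` of the chart engine
`InBaker.of_Hhalf` (part 47) by the frontier of the chart domain and the wall locus (the pieces `v = 0`,
`m v² = 1`, `H(ζ) = 0` — part 48 — and the vertical lines `k₂ = 0` are discharged; the sections running on a
line with `k₂ ≠ 0` or on a conic wall are the typed residual families `R-HL`, `R-HC`, taken as hypotheses),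
and `InBaker.of_Hhalf'` is the chart engine with these typed residuals.

References: [KontsevichZagier2001 §1.2 rules (1)–(3)], [BCR1998 §2.2].
-/

noncomputable section
/-- `(x, t)₀ = x₀` on `Fin 2`. [bookkeeping] -/
private theorem snoc₂_zero (x : Fin 1 → ℝ) (t : ℝ) : (Fin.snoc x t : Fin 2 → ℝ) 0 = x 0 := rfl

/-- `(x, t)₁ = t` on `Fin 2`. [bookkeeping] -/
private theorem snoc₂_one (x : Fin 1 → ℝ) (t : ℝ) : (Fin.snoc x t : Fin 2 → ℝ) 1 = t := rfl

open Set MeasureTheory MvPolynomial Literature.NumberTheory.Transcendental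
open Literature.ModelTheory.ExponentialFields (IsSemialgebraic isSemialgebraic_univ isSemialgebraic_empty)
open Summit.KontsevichZagierPeriods.RootDecompWalshStrata.ConicDescent.VertexChart

namespace Summit.KontsevichZagierPeriods.RootDecompWalshStrata.ConicDescent.BallCube

/-! #### 48.3 The section dispatcher and the engine with typed residuals -/

/-- **BOUNDARY SECTIONS OF THE CHART DOMAIN (rule (1)).**  For `U ⊆ {0 < x < 1, 0 < y}` open with
`closure U ∖ U ⊆ wallLocus R_H ℓ q`, `0 < e`, `1 ≤ m`, every boundary section `[S, P(v, ζ(v))]` of the chart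
engine over `hDom e g m U` is in the Baker sector, GIVEN the two residual families (universally quantified,
so that they can be carried to the head of the node unchanged):
`R-HL` — sections whose chart point runs on a line with `k₂ ≠ 0`;
`R-HC` — sections whose chart point runs on a conic wall `R_H = Q²`.
The pieces `v = 0`, `m v² = 1`, `H(ζ) = 0` and the vertical lines `k₂ = 0` are discharged here.
[KontsevichZagier2001 §1.2 rule (1); this node] -/
theorem InBaker.of_Hsections {e g m : ℚ} (he : 0 < e) (hm : 1 ≤ m) (γ : ℚ) {n k : ℕ} (ℓ : Fin n → Wall)
    (q : Fin k → Wall) {U : Set (Fin 2 → ℝ)} (hUo : IsOpen U)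
    (hUT : U ⊆ {u | 0 < u 0 ∧ u 0 < 1 ∧ 0 < u 1})
    (hfr : ∀ u ∈ closure U, u ∉ U → u ∈ wallLocus (hrad e g m) ℓ q)
    (hl : (∀ (e g m γ : ℚ), 0 < e → 1 ≤ m → ∀ (L : Wall), L.k2 ≠ 0 →
      ∀ (T : Set (Fin 1 → ℝ)) (ζ : (Fin 1 → ℝ) → ℝ), IsSemialgebraic ℚ T → T ⊆ Icc 0 1 →
        IsSemialgebraicFunOn ℚ T ζ → ContinuousOn ζ T →
        (∀ b ∈ T, (0 < b 0 ∧ (m : ℝ) * b 0 ^ 2 < 1) ∧ (0 ≤ ζ b ∧ ζ b ≤ 1) ∧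
          0 < (e : ℝ) * ζ b ^ 2 + g ∧
          L.eval (ζ b) (√((e : ℝ) * ζ b ^ 2 + g) * gU m (b 0)) = 0) →
        ∀ r : KZ.IntegralRep 1, r.domain = T →
          EqOn r.integrand (fun b => (γ : ℝ) * ((e : ℝ) / 3 * ζ b ^ 3 + g * ζ b) * gW m (b 0)) T →
          InBaker (KZ.of r)))
    (hc : (∀ (e g m γ : ℚ), 0 < e → 1 ≤ m → ∀ (Q : Wall),
      ∀ (T : Set (Fin 1 → ℝ)) (ζ : (Fin 1 → ℝ) → ℝ), IsSemialgebraic ℚ T → T ⊆ Icc 0 1 →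
        IsSemialgebraicFunOn ℚ T ζ → ContinuousOn ζ T →
        (∀ b ∈ T, (0 < b 0 ∧ (m : ℝ) * b 0 ^ 2 < 1) ∧ (0 ≤ ζ b ∧ ζ b ≤ 1) ∧
          0 < (e : ℝ) * ζ b ^ 2 + g ∧
          ((e : ℝ) * ζ b ^ 2 + g) * gT m (b 0) ^ 2 =
            (Q.eval (ζ b) (√((e : ℝ) * ζ b ^ 2 + g) * gU m (b 0))) ^ 2) →
        ∀ r : KZ.IntegralRep 1, r.domain = T →
          EqOn r.integrand (fun b => (γ : ℝ) * ((e : ℝ) / 3 * ζ b ^ 3 + g * ζ b) * gW m (b 0)) T →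
          InBaker (KZ.of r)))
    {S : Set (Fin 1 → ℝ)} {ζ : (Fin 1 → ℝ) → ℝ} (hS : IsSemialgebraic ℚ S)
    (hζ : IsSemialgebraicFunOn ℚ S ζ) (hζc : ContinuousOn ζ S)
    (hgr : ∀ b ∈ S, (Fin.snoc b (ζ b) : Fin 2 → ℝ) ∈ frontier (hDom e g m U))
    (r₁ : KZ.IntegralRep 1) (hr₁d : r₁.domain = S)
    (hr₁i : EqOn r₁.integrand (fun b => hpot γ e g m (Fin.snoc b (ζ b))) S) :
    InBaker (KZ.of r₁) := by
  classical
  have hm0 : (0 : ℚ) ≤ m := zero_le_one.trans hm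
  -- bounds from the unit square
  have hWI : hDom e g m U ⊆ Icc 0 1 := fun p hp =>
    ⟨fun j => ((hDom_subset_box (e := e) (g := g) hm hUT hp) j).1.le,
      fun j => ((hDom_subset_box (e := e) (g := g) hm hUT hp) j).2.le⟩
  have hclI : closure (hDom e g m U) ⊆ Icc 0 1 := closure_minimal hWI isClosed_Icc
  have hbI : ∀ b ∈ S, (0 ≤ b 0 ∧ b 0 ≤ 1) ∧ (0 ≤ ζ b ∧ ζ b ≤ 1) := fun b hb => by
    have h := hclI (frontier_subset_closure (hgr b hb))
    refine ⟨⟨?_, ?_⟩, ?_, ?_⟩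
    · have := h.1 0; rwa [Pi.zero_apply, snoc₂_zero] at this
    · have := h.2 0; rwa [Pi.one_apply, snoc₂_zero] at this
    · have := h.1 1; rwa [Pi.zero_apply, snoc₂_one] at this
    · have := h.2 1; rwa [Pi.one_apply, snoc₂_one] at this
  have hTI : ∀ T, T ⊆ S → T ⊆ Icc (0 : Fin 1 → ℝ) 1 := fun T hT b hb =>
    ⟨fun j => by rw [Subsingleton.elim j 0]; exact ((hbI b (hT hb)).1).1,
      fun j => by rw [Subsingleton.elim j 0]; exact ((hbI b (hT hb)).1).2⟩
  -- frontier facts along the graph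
  have hFr : ∀ b ∈ S, ((m : ℝ) * b 0 ^ 2 ≤ 1 ∧ 0 ≤ (e : ℝ) * ζ b ^ 2 + g) ∧
      ((Fin.snoc b (ζ b) : Fin 2 → ℝ) ∈ hBase e g m →
        vΦ m 0 (hP e g) (Fin.snoc b (ζ b)) ∈ closure U ∧ vΦ m 0 (hP e g) (Fin.snoc b (ζ b)) ∉ U) :=
    fun b hb => frontier_hDom hm0 hUo (hgr b hb)
  -- semialgebraic functions along the graph
  have hb0 : IsSemialgebraicFunOn ℚ S fun b : Fin 1 → ℝ => b 0 := isSemialgebraicFunOn_apply hS 0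
  have hV : IsSemialgebraicFunOn ℚ S fun b : Fin 1 → ℝ => 1 - (m : ℝ) * b 0 ^ 2 :=
    (isSemialgebraicFunOn_aeval hS (1 - C m * X 0 ^ 2 : MvPolynomial (Fin 1) ℚ)).congr fun b _ => by
      simp only [map_sub, map_one, map_mul, map_pow, MvPolynomial.aeval_C, MvPolynomial.aeval_X,
        eq_ratCast]
  have hHg : IsSemialgebraicFunOn ℚ S fun b => (e : ℝ) * ζ b ^ 2 + g :=
    isSemialgebraicFunOn_comp_snoc (N := 1) hS (isSemialgebraicFunOn_hH e g) hζ
  have hRg : IsSemialgebraicFunOn ℚ S fun b => hrad e g m (vΦ m 0 (hP e g) (Fin.snoc b (ζ b))) :=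
    isSemialgebraicFunOn_comp_snoc (N := 1) hS (isSemialgebraicFunOn_hrad_vΦ hm0) hζ
  have hLg : ∀ L : Wall, IsSemialgebraicFunOn ℚ S fun b =>
      L.eval (vΦ m 0 (hP e g) (Fin.snoc b (ζ b)) 0) (vΦ m 0 (hP e g) (Fin.snoc b (ζ b)) 1) := fun L =>
    isSemialgebraicFunOn_comp_snoc (N := 1) hS (L.isSemialgebraicFunOn_eval_vΦ hm0) hζ
  -- the pieces
  let Z0 : Set (Fin 1 → ℝ) := {b | b ∈ S ∧ b 0 = ((0 : ℚ) : ℝ)}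
  let Z1 : Set (Fin 1 → ℝ) := {b | b ∈ S ∧ 1 - (m : ℝ) * b 0 ^ 2 = ((0 : ℚ) : ℝ)}
  let ZH : Set (Fin 1 → ℝ) := {b | b ∈ S ∧ (e : ℝ) * ζ b ^ 2 + g = ((0 : ℚ) : ℝ)}
  let Zp : Set (Fin 1 → ℝ) := ZH ∩ {b | b ∈ S ∧ 0 ≤ ζ b}
  let Zn : Set (Fin 1 → ℝ) := ZH ∩ {b | b ∈ S ∧ 0 ≤ -ζ b}
  let B : Set (Fin 1 → ℝ) := {b | b ∈ S ∧ 0 < b 0} ∩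
    ({b | b ∈ S ∧ 0 < 1 - (m : ℝ) * b 0 ^ 2} ∩ {b | b ∈ S ∧ 0 < (e : ℝ) * ζ b ^ 2 + g})
  let Al : Fin n → Set (Fin 1 → ℝ) := fun i => B ∩
    {b | b ∈ S ∧ (ℓ i).eval (vΦ m 0 (hP e g) (Fin.snoc b (ζ b)) 0)
      (vΦ m 0 (hP e g) (Fin.snoc b (ζ b)) 1) = ((0 : ℚ) : ℝ) ∧ ((ℓ i).k1 ≠ 0 ∨ (ℓ i).k2 ≠ 0)}
  let Aq : Fin k → Set (Fin 1 → ℝ) := fun j => B ∩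
    {b | b ∈ S ∧ hrad e g m (vΦ m 0 (hP e g) (Fin.snoc b (ζ b))) =
      (q j).eval (vΦ m 0 (hP e g) (Fin.snoc b (ζ b)) 0) (vΦ m 0 (hP e g) (Fin.snoc b (ζ b)) 1) *
        (q j).eval (vΦ m 0 (hP e g) (Fin.snoc b (ζ b)) 0) (vΦ m 0 (hP e g) (Fin.snoc b (ζ b)) 1)}
  let A : Bool ⊕ Bool ⊕ (Fin n ⊕ Fin k) → Set (Fin 1 → ℝ) := fun o =>
    match o with
    | Sum.inl false => Z0
    | Sum.inl true => Z1
    | Sum.inr (Sum.inl false) => Zp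
    | Sum.inr (Sum.inl true) => Zn
    | Sum.inr (Sum.inr (Sum.inl i)) => Al i
    | Sum.inr (Sum.inr (Sum.inr j)) => Aq j
  have hZ0 : IsSemialgebraic ℚ Z0 := isSemialgebraic_sep_eq hb0 (isSemialgebraicFunOn_ratCast hS 0)
  have hZ1 : IsSemialgebraic ℚ Z1 := isSemialgebraic_sep_eq hV (isSemialgebraicFunOn_ratCast hS 0)
  have hZH : IsSemialgebraic ℚ ZH := isSemialgebraic_sep_eq hHg (isSemialgebraicFunOn_ratCast hS 0)
  have hZp : IsSemialgebraic ℚ Zp := hZH.inter hζ.isSemialgebraic_sep_nonneg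
  have hZn : IsSemialgebraic ℚ Zn := hZH.inter hζ.neg.isSemialgebraic_sep_nonneg
  have hB : IsSemialgebraic ℚ B :=
    (IsSemialgebraicFunOn.isSemialgebraic_sep_pos hb0).inter
      ((IsSemialgebraicFunOn.isSemialgebraic_sep_pos hV).inter
        (IsSemialgebraicFunOn.isSemialgebraic_sep_pos hHg))
  have hAl : ∀ i, IsSemialgebraic ℚ (Al i) := by
    intro i
    by_cases hg : (ℓ i).k1 ≠ 0 ∨ (ℓ i).k2 ≠ 0
    · have := isSemialgebraic_sep_eq (hLg (ℓ i)) (isSemialgebraicFunOn_ratCast hS 0)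
      refine hB.inter ?_
      convert this using 1
      ext b
      simp only [mem_setOf_eq, hg, and_true]
    · have : Al i = ∅ := eq_empty_of_forall_notMem fun b hb => hg hb.2.2.2
      rw [this]
      exact isSemialgebraic_empty
  have hAq : ∀ j, IsSemialgebraic ℚ (Aq j) := fun j =>
    hB.inter (isSemialgebraic_sep_eq hRg ((hLg (q j)).mul_holds (hLg (q j))))
  refine InBaker.of_cover' r₁ A ?_ ?_ ?_
  · rintro ((_ | _) | (_ | _) | i | j)
    · exact hZ0
    · exact hZ1
    · exact hZp
    · exact hZn
    · exact hAl i
    · exact hAq j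
  · -- the cover
    intro b hb
    have hbS : b ∈ S := by rw [← hr₁d]; exact hb
    rcases eq_or_ne (b 0) 0 with h0 | h0
    · exact mem_iUnion.2 ⟨Sum.inl false, hbS, by rw [h0, Rat.cast_zero]⟩
    have hF := hFr b hbS
    rcases hF.1.1.eq_or_lt with h1 | h1
    · exact mem_iUnion.2 ⟨Sum.inl true, hbS, by rw [h1, Rat.cast_zero, sub_self]⟩
    rcases hF.1.2.eq_or_lt with h2 | h2
    · rcases le_total 0 (ζ b) with hz | hz
      · exact mem_iUnion.2 ⟨Sum.inr (Sum.inl false), ⟨hbS, by rw [← h2, Rat.cast_zero]⟩, hbS, hz⟩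
      · exact mem_iUnion.2
          ⟨Sum.inr (Sum.inl true), ⟨hbS, by rw [← h2, Rat.cast_zero]⟩, hbS, by linarith⟩
    have hb0' : 0 < b 0 := lt_of_le_of_ne (hbI b hbS).1.1 (Ne.symm h0)
    have hBm : b ∈ B := ⟨⟨hbS, hb0'⟩, ⟨hbS, by linarith⟩, ⟨hbS, h2⟩⟩
    have hbase : (Fin.snoc b (ζ b) : Fin 2 → ℝ) ∈ hBase e g m := by
      rw [mem_hBase, snoc₂_zero, snoc₂_one]
      exact ⟨h1, h2⟩
    obtain ⟨hcl, hnU⟩ := hF.2 hbase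
    rcases hfr _ hcl hnU with hR | ⟨i, hg, hi⟩ | ⟨j, hj⟩
    · exact absurd hR (hrad_vΦ_pos hm0 hbase).ne'
    · exact mem_iUnion.2 ⟨Sum.inr (Sum.inr (Sum.inl i)), hBm, hbS, by rw [hi, Rat.cast_zero], hg⟩
    · exact mem_iUnion.2 ⟨Sum.inr (Sum.inr (Sum.inr j)), hBm, hbS, by rw [hj, sq]⟩
  · rintro ((_ | _) | (_ | _) | i | j) T hT hTr hTA
    · -- `v = 0`: null
      exact InBaker.of_subset_zeroSet _ (X 0) ⟨fun _ => 1, by simp⟩ fun b hb => by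
        simpa using (hTA hb).2
    · -- `m v² = 1`: null (the potential even vanishes there)
      refine InBaker.of_subset_zeroSet _ (1 - C m * X 0 ^ 2) ⟨fun _ => 0, by simp⟩ fun b hb => ?_
      have h := (hTA hb).2
      rw [Rat.cast_zero] at h
      simpa only [map_sub, map_one, map_mul, map_pow, MvPolynomial.aeval_C, MvPolynomial.aeval_X,
        eq_ratCast] using h
    · -- `H = 0`, `ζ ≥ 0`
      exact InBaker.of_hzero_section he hm0 γ 1 (Or.inl rfl) _
        (fun b hb => ⟨by simpa only [Rat.cast_zero] using (hTA hb).1.2,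
          by rw [Rat.cast_one, one_mul]; exact (hTA hb).2.2⟩)
        fun b hb => hr₁i (hTA hb).1.1
    · -- `H = 0`, `ζ ≤ 0`
      exact InBaker.of_hzero_section he hm0 γ (-1) (Or.inr rfl) _
        (fun b hb => ⟨by simpa only [Rat.cast_zero] using (hTA hb).1.2,
          by rw [Rat.cast_neg, Rat.cast_one, neg_one_mul]; exact (hTA hb).2.2⟩)
        fun b hb => hr₁i (hTA hb).1.1
    · -- a genuine listed line
      by_cases hT0 : T = ∅
      · exact InBaker.of_domain_eq_empty _ hT0
      obtain ⟨x₀, hx₀⟩ := nonempty_iff_ne_empty.2 hT0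
      have hTS : T ⊆ S := fun b hb => (hTA hb).1.1.1
      have hg : (ℓ i).k1 ≠ 0 ∨ (ℓ i).k2 ≠ 0 := (hTA hx₀).2.2.2
      have hfacts : ∀ b ∈ T, (0 < b 0 ∧ (m : ℝ) * b 0 ^ 2 < 1) ∧ (0 ≤ ζ b ∧ ζ b ≤ 1) ∧
          0 < (e : ℝ) * ζ b ^ 2 + g ∧
          (ℓ i).eval (ζ b) (√((e : ℝ) * ζ b ^ 2 + g) * gU m (b 0)) = 0 := fun b hb => by
        obtain ⟨⟨⟨-, hv0⟩, ⟨-, hv1⟩, ⟨-, hH⟩⟩, ⟨-, hev, -⟩⟩ := hTA hb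
        rw [(vΦ_snoc b (ζ b)).1, (vΦ_snoc b (ζ b)).2, Rat.cast_zero] at hev
        exact ⟨⟨hv0, by linarith⟩, (hbI b (hTS hb)).2, hH, hev⟩
      have hint : EqOn (r₁.restrict T hT hTr).integrand
          (fun b => (γ : ℝ) * ((e : ℝ) / 3 * ζ b ^ 3 + g * ζ b) * gW m (b 0)) T := fun b hb => by
        show r₁.integrand b = _
        rw [hr₁i (hTS hb)]
        dsimp only
        rw [hpot_eq, snoc₂_zero, snoc₂_one]
      by_cases h2 : (ℓ i).k2 ≠ 0
      · exact hl e g m γ he hm (ℓ i) h2 T ζ hT (hTI T hTS) (hζ.mono hTS hT) (hζc.mono hTS) hfacts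
          (r₁.restrict T hT hTr) rfl hint
      · -- `k₂ = 0`, `k₁ ≠ 0`: a vertical line, `ζ ≡ −k₀/k₁`, rational integrand
        rw [not_not] at h2
        have h1 : (ℓ i).k1 ≠ 0 := hg.resolve_right (not_not.2 h2)
        have h1' : ((ℓ i).k1 : ℝ) ≠ 0 := by exact_mod_cast h1
        obtain ⟨x₁, hx₁⟩ : ∃ x₁ : ℚ, x₁ = -(ℓ i).k0 / (ℓ i).k1 := ⟨_, rfl⟩
        have hxv : ∀ b ∈ T, ζ b = (x₁ : ℝ) := fun b hb => by
          have h := (hfacts b hb).2.2.2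
          rw [Wall.eval, h2, Rat.cast_zero, zero_mul, add_zero] at h
          rw [hx₁]
          push_cast
          rw [eq_div_iff h1']
          linarith
        refine InBaker.of_eqOn_aeval_div _
          (C (2 * γ * (e / 3 * x₁ ^ 3 + g * x₁)) * (1 - C m * X 0 ^ 2) ^ 2)
          ((1 + C m * X 0 ^ 2) ^ 3) (fun b _ => ?_) fun b hb => ?_
        · have h : (0 : ℝ) < (1 + (m : ℝ) * b 0 ^ 2) ^ 3 := pow_pos (one_add_pos hm0 (b 0)) 3
          simpa using h.ne'
        · rw [hint hb]
          dsimp only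
          rw [hxv b hb]
          have hden : (1 + (m : ℝ) * b 0 ^ 2) ^ 3 ≠ 0 := (pow_pos (one_add_pos hm0 (b 0)) 3).ne'
          simp only [map_mul, map_pow, map_sub, map_add, map_one, MvPolynomial.aeval_C,
            MvPolynomial.aeval_X, eq_ratCast, gW]
          push_cast
          rw [eq_div_iff hden]
          field_simp
          try ring
    · -- a conic wall
      have hTS : T ⊆ S := fun b hb => (hTA hb).1.1.1
      have hfacts : ∀ b ∈ T, (0 < b 0 ∧ (m : ℝ) * b 0 ^ 2 < 1) ∧ (0 ≤ ζ b ∧ ζ b ≤ 1) ∧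
          0 < (e : ℝ) * ζ b ^ 2 + g ∧
          ((e : ℝ) * ζ b ^ 2 + g) * gT m (b 0) ^ 2 =
            ((q j).eval (ζ b) (√((e : ℝ) * ζ b ^ 2 + g) * gU m (b 0))) ^ 2 := fun b hb => by
        obtain ⟨⟨⟨-, hv0⟩, ⟨-, hv1⟩, ⟨-, hH⟩⟩, ⟨-, hev⟩⟩ := hTA hb
        rw [(vΦ_snoc b (ζ b)).1, (vΦ_snoc b (ζ b)).2, ← sq, hrad_vΦ hm0 _ (by rw [snoc₂_one]; exact hH.le),
          snoc₂_zero, snoc₂_one] at hev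
        exact ⟨⟨hv0, by linarith⟩, (hbI b (hTS hb)).2, hH, hev⟩
      have hint : EqOn (r₁.restrict T hT hTr).integrand
          (fun b => (γ : ℝ) * ((e : ℝ) / 3 * ζ b ^ 3 + g * ζ b) * gW m (b 0)) T := fun b hb => by
        show r₁.integrand b = _
        rw [hr₁i (hTS hb)]
        dsimp only
        rw [hpot_eq, snoc₂_zero, snoc₂_one]
      exact hc e g m γ he hm (q j) T ζ hT (hTI T hTS) (hζ.mono hTS hT) (hζc.mono hTS) hfacts
        (r₁.restrict T hT hTr) rfl hint

/-- **The H-type chart engine with typed residuals.** `InBaker.of_Hhalf` + `InBaker.of_Hsections`: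
for an open `σ.domain ⊆ {0 < x < 1, 0 < y}` with `closure ∖ interior ⊆ wallLocus R_H ℓ q`, `R_H > 0` on it,
`0 < e`, `1 ≤ m`, and `σ.integrand = γ√R_H`: `[σ] ∈ InBaker` modulo `R-HL`, `R-HC`. [this node] -/
theorem InBaker.of_Hhalf' {e g m : ℚ} (he : 0 < e) (hm : 1 ≤ m) (γ : ℚ) {n k : ℕ} (ℓ : Fin n → Wall)
    (q : Fin k → Wall) (σ : KZ.IntegralRep 2) (hσo : IsOpen σ.domain)
    (hσT : σ.domain ⊆ {u | 0 < u 0 ∧ u 0 < 1 ∧ 0 < u 1})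
    (hfr : ∀ u ∈ closure σ.domain, u ∉ σ.domain → u ∈ wallLocus (hrad e g m) ℓ q)
    (hD : ∀ u ∈ σ.domain, 0 < hrad e g m u)
    (hσi : ∀ u ∈ σ.domain, σ.integrand u = (γ : ℝ) * √(hrad e g m u))
    (hl : (∀ (e g m γ : ℚ), 0 < e → 1 ≤ m → ∀ (L : Wall), L.k2 ≠ 0 →
      ∀ (T : Set (Fin 1 → ℝ)) (ζ : (Fin 1 → ℝ) → ℝ), IsSemialgebraic ℚ T → T ⊆ Icc 0 1 →
        IsSemialgebraicFunOn ℚ T ζ → ContinuousOn ζ T →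
        (∀ b ∈ T, (0 < b 0 ∧ (m : ℝ) * b 0 ^ 2 < 1) ∧ (0 ≤ ζ b ∧ ζ b ≤ 1) ∧
          0 < (e : ℝ) * ζ b ^ 2 + g ∧
          L.eval (ζ b) (√((e : ℝ) * ζ b ^ 2 + g) * gU m (b 0)) = 0) →
        ∀ r : KZ.IntegralRep 1, r.domain = T →
          EqOn r.integrand (fun b => (γ : ℝ) * ((e : ℝ) / 3 * ζ b ^ 3 + g * ζ b) * gW m (b 0)) T →
          InBaker (KZ.of r)))
    (hc : (∀ (e g m γ : ℚ), 0 < e → 1 ≤ m → ∀ (Q : Wall),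
      ∀ (T : Set (Fin 1 → ℝ)) (ζ : (Fin 1 → ℝ) → ℝ), IsSemialgebraic ℚ T → T ⊆ Icc 0 1 →
        IsSemialgebraicFunOn ℚ T ζ → ContinuousOn ζ T →
        (∀ b ∈ T, (0 < b 0 ∧ (m : ℝ) * b 0 ^ 2 < 1) ∧ (0 ≤ ζ b ∧ ζ b ≤ 1) ∧
          0 < (e : ℝ) * ζ b ^ 2 + g ∧
          ((e : ℝ) * ζ b ^ 2 + g) * gT m (b 0) ^ 2 =
            (Q.eval (ζ b) (√((e : ℝ) * ζ b ^ 2 + g) * gU m (b 0))) ^ 2) →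
        ∀ r : KZ.IntegralRep 1, r.domain = T →
          EqOn r.integrand (fun b => (γ : ℝ) * ((e : ℝ) / 3 * ζ b ^ 3 + g * ζ b) * gW m (b 0)) T →
          InBaker (KZ.of r))) :
    InBaker (KZ.of σ) :=
  InBaker.of_Hhalf hm γ e g σ hσo hσT hD hσi fun _ _ hS hζ hζc hgr r₁ hr₁d hr₁i =>
    InBaker.of_Hsections he hm γ ℓ q hσo hσT hfr hl hc hS hζ hζc hgr r₁ hr₁d hr₁i

end Summit.KontsevichZagierPeriods.RootDecompWalshStrata.ConicDescent.BallCube
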